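import Summits.RiemannHypothesis.RiemannHypothesis.Theorems.Splittings.BombieriTruncSynthesisRows
import Literature.NumberTheory.LFunctions.LittlewoodZeroGapsProofs
import HarnessLib

/-!
# Splittings — x-wuc (xiv-d) rows with Littlewood's gap theorem DISCHARGED

Cell rh-split, seat rh-split-typer-2 g4 (own work, not a carve).  The rows of record of
`Splittings/BombieriTruncSynthesisRows.lean` (card `run/shared/lean/pub/rh-split/cards/SPLIT-x-wuc.md` §13) carry the named print
fact `Literature.NumberTheory.LFunctions.littlewood_zero_ordinate_gaps_shrink` [Titchmarsh Thm 9.11/9.12] in hypothesis position.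
That fact is now a THEOREM of the tree (`Literature.NumberTheory.LFunctions.littlewood_zero_ordinate_gaps_shrink_holds`,
`Literature/NumberTheory/LFunctions/LittlewoodZeroGapsProofs.lean`: Titchmarsh §9.12 first proof with a fixed width —
Borel–Carathéodory + Hadamard three circles along a chain of discs from `3 + iT` to `−1/2 + iT`), so the hypothesis is removed:

* `zeroOrdinateGapsShrink_holds : ZeroOrdinateGapsShrink` — input D5′ of the card, now in kernel;
* `synthesisScreening_holds : SynthesisScreening` — T7 unconditionally;
* `rh_iff_offLineBoundedMult_and_boundedAway_C5 (h5 : Corollary11Prov) : RH ↔ BM_off ∧ B′([−1,1])` (row X-6), `rh_iff_esm_or_obm_and_boundedAway_C5`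
  (row X-6∨), `boundedAway_one_iff_rh_of_offLineBoundedMult_C5` (row X-6s) — now modulo the ONE print fact `Corollary11Prov`
  [Bombieri 2000 Thm 11/Cor.] only;
* `not_boundedAway_of_offLineBoundedMult_of_not_cofinite : OffLineBoundedMult → ¬CofiniteCriticalLine → ¬B′([−1,1])` — the FOZ-free
  content of X-6, now HYPOTHESIS-FREE (no print fact, no RH).

LABEL (unchanged in class): rows X-6/X-6∨/X-6s remain CONDITIONAL bookkeeping modulo `Corollary11Prov`; RH-equivalence typing,
certifies nothing about RH.  HONEST LABEL: «SPLITTING SEARCH over kernel-typed RH-EQUIVALENCES; a splitting A ∧ B ⟹ RH is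
CONDITIONAL bookkeeping unless A and B are both proved; nothing here bears on the truth of RH.»
-/

noncomputable section

open Set

namespace Summit.RiemannHypothesis.RiemannHypothesis.Theorems.Splittings.BombieriTruncSynthesisLittlewood

open Literature.NumberTheory.LFunctions Literature.NumberTheory.LFunctions.Bombieri2000
open Summit.RiemannHypothesis.RiemannHypothesis.Theses.RuelleBand
open Summit.RiemannHypothesis.RiemannHypothesis.Theorems.Splittings.BombieriTruncEigen
open Summit.RiemannHypothesis.RiemannHypothesis.Theorems.Splittings.BombieriFozNoDep
open Summit.RiemannHypothesis.RiemannHypothesis.Theorems.Splittings.BombieriTruncMultiplicity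
open Summit.RiemannHypothesis.RiemannHypothesis.Theorems.Splittings.BombieriTruncEventualStrip
open Summit.RiemannHypothesis.RiemannHypothesis.Theorems.Splittings.BombieriTruncOffLineSparse
open Summit.RiemannHypothesis.RiemannHypothesis.Theorems.Splittings.BombieriTruncSynthesisScreening
open Summit.RiemannHypothesis.RiemannHypothesis.Theorems.Splittings.BombieriTruncSynthesisRows

/-- **D5′ in kernel:** every large `T` is within any prescribed `ε > 0` of the ordinate of a non-trivial zero of `ζ`
(Littlewood; Titchmarsh Thm 9.11) — the card's input `ZeroOrdinateGapsShrink`, from the tree's theorem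
`littlewood_zero_ordinate_gaps_shrink_holds`. [KERNEL] -/
theorem zeroOrdinateGapsShrink_holds : ZeroOrdinateGapsShrink :=
  zeroOrdinateGapsShrink_of_littlewood littlewood_zero_ordinate_gaps_shrink_holds

/-- **T7 unconditionally:** `SynthesisScreening` holds (PA = `nearLatticeSynthesis`, D5′ = `zeroOrdinateGapsShrink_holds`). [KERNEL] -/
theorem synthesisScreening_holds : SynthesisScreening :=
  synthesisScreening_of_gaps zeroOrdinateGapsShrink_holds

open Summit.RiemannHypothesis.RiemannHypothesis.Theorems.Splittings.BombieriCorollaryProvenance in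
/-- **Row X-6:** `RH ⟺ BM_off ∧ B′([−1,1])` modulo the single print fact `Corollary11Prov` [Bombieri 2000 Thm 11/Cor.].
LABEL: CONDITIONAL bookkeeping (one print fact in hypothesis position); certifies nothing about RH. -/
theorem rh_iff_offLineBoundedMult_and_boundedAway_C5 (h5 : Corollary11Prov) :
    _root_.RiemannHypothesis ↔ OffLineBoundedMult ∧ TruncNegEigenvalueBoundedAway (Icc (-1 : ℝ) 1) :=
  rh_iff_offLineBoundedMult_and_boundedAway_g7b h5 zeroOrdinateGapsShrink_holds

open Summit.RiemannHypothesis.RiemannHypothesis.Theorems.Splittings.BombieriCorollaryProvenance in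
/-- **Row X-6∨:** `RH ⟺ (ES_m ∨ BM_off) ∧ B′([−1,1])` modulo `Corollary11Prov` only. LABEL: CONDITIONAL bookkeeping. -/
theorem rh_iff_esm_or_obm_and_boundedAway_C5 (h5 : Corollary11Prov) :
    _root_.RiemannHypothesis ↔
      (EventualStripMult ∨ OffLineBoundedMult) ∧ TruncNegEigenvalueBoundedAway (Icc (-1 : ℝ) 1) :=
  rh_iff_esm_or_obm_and_boundedAway_g7b h5 zeroOrdinateGapsShrink_holds

open Summit.RiemannHypothesis.RiemannHypothesis.Theorems.Splittings.BombieriCorollaryProvenance in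
/-- **Row X-6s:** given `M`-bounded OFF-LINE multiplicities, `B′([−1,1]) ⟺ RH` modulo `Corollary11Prov` only.
LABEL: CONDITIONAL bookkeeping. -/
theorem boundedAway_one_iff_rh_of_offLineBoundedMult_C5 (h5 : Corollary11Prov) (hBM : OffLineBoundedMult) :
    TruncNegEigenvalueBoundedAway (Icc (-1 : ℝ) 1) ↔ _root_.RiemannHypothesis :=
  boundedAway_one_iff_rh_of_offLineBoundedMult_g7b h5 zeroOrdinateGapsShrink_holds hBM

/-- **The FOZ-free content of X-6, HYPOTHESIS-FREE:** bounded off-line multiplicities together with infinitely many off-line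
zeros force `¬B′([−1,1])` — no print fact, no RH (the Littlewood input is now the tree's theorem). [KERNEL] -/
theorem not_boundedAway_of_offLineBoundedMult_of_not_cofinite (hBM : OffLineBoundedMult)
    (hnotfoz : ¬ CofiniteCriticalLine) : ¬ TruncNegEigenvalueBoundedAway (Icc (-1 : ℝ) 1) :=
  not_boundedAway_of_obm_of_not_foz_g7b zeroOrdinateGapsShrink_holds hBM hnotfoz

end Summit.RiemannHypothesis.RiemannHypothesis.Theorems.Splittings.BombieriTruncSynthesisLittlewood

end
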